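import Summits.ABC.ABC.Theses.FeketeScales
import HarnessLib

/-!
# Crux `SparseGoodScales` (stmt-ABC-2161) — round-2 ideator 5: support lemmas (no line)

Kernel-checked companions of `BarrierNotes-r2-k5.md` (crux-ideate round 2, ideator 5,
seat `planner-cruxidea-stmt-ABC-2161-5-0`).  No skeleton / no stubs: this seat files NO line for
the crux (see the notes for why); the lemmas below are the provable packaging it relies on, ready
to land beside `Theorems/FeketeScalesSparseGoodScalesWindow.lean` with `--supports stmt-ABC-2161`
by any idle prover.

1. `GoodScale δ R` — the matrix of the crux; `sparseGoodScales_iff_goodScale` (`Iff.rfl`).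
2. GEOMETRIC DISCRETISATION: for every base `q ≥ 2`,
   `SparseGoodScales ↔ GeometricGoodScales q` (good scales may be sought among the powers `q^j`
   only; the loss `R ↦ q^⌊log_q R⌋` costs a factor `q^{1+δ/2}`, absorbed by `δ/2 ↦ δ` once
   `j ≥ 2/δ + 1`).  Corollary `not_sparseGoodScales_iff_profile`: the NEGATION of the crux is
   exactly the existence of a "Silverman-profile" sequence — for some `δ₀ > 0`, below EVERY large
   power `q^j` an abc triple of radical `≤ q^j` and height `> q^{j(1+δ₀)}` — i.e. precisely the
   growth profile that the family `(1, q^{nj} − 1, q^{nj})` realises in the all-Wieferich world of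
   `Theorems/FeketeScalesSparseGoodScalesWieferich.lean`, with the support of `c` set free.
3. FUNCTION-FIELD FLOOR (calibration of the Wieferich floor p99695): over `F[X]` the Wieferich
   congruence `P² ∣ a^m − 1` with `(m : F) = −1` (e.g. `m = |F|^{deg P} − 1` in characteristic
   `p`) forces `P ∣ a′` — so for a base `a` with `a′ ≠ 0` only the finitely many primes dividing
   `a′` are Wieferich: the integer floor "infinitely many non-Wieferich primes to base q"
   (open, Ribenboim 2004 Ch. 5 §III problem (2)) is the shadow of a one-line differentiation, the
   literal content of `Literature.Barriers.ABC.NoArithmeticDerivative` for THIS crux.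
-/

set_option linter.dupNamespace false

namespace Summit.ABC.ABC.Cruxes.SparseGoodScales.GeometricScales

open Literature.NumberTheory.DiophantineGeometry
open Summit.ABC.ABC.Theses.FeketeScales

/-- `δ`-goodness of the radical scale `R`: every abc triple of radical `≤ R` has `c ≤ R^{1+δ}`.
[folklore] -/
def GoodScale (δ : ℝ) (R : ℕ) : Prop :=
  ∀ a b c : ℕ, IsABCTriple a b c → rad a b c ≤ R → (c : ℝ) ≤ (R : ℝ) ^ (1 + δ)

/-- The crux, unfolded: good scales beyond every bound, for every `δ > 0`. [folklore] -/
theorem sparseGoodScales_iff_goodScale :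
    SparseGoodScales ↔ ∀ δ : ℝ, 0 < δ → ∀ N : ℕ, ∃ R : ℕ, N ≤ R ∧ GoodScale δ R :=
  Iff.rfl

/-- Good scales sought among the powers of a fixed base only. [folklore] -/
def GeometricGoodScales (q : ℕ) : Prop :=
  ∀ δ : ℝ, 0 < δ → ∀ N : ℕ, ∃ j : ℕ, N ≤ j ∧ GoodScale δ (q ^ j)

/-- Rounding a good scale down to a power of `q`: if `R` is `δ/2`-good, `q^j ≤ R < q^{j+1}` and
`j ≥ 2/δ + 1`, then `q^j` is `δ`-good. [folklore] -/
theorem goodScale_pow_of_goodScale {q : ℕ} (hq : 2 ≤ q) {δ : ℝ} (hδ : 0 < δ) {R j : ℕ}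
    (hjR : q ^ j ≤ R) (hRj : R < q ^ (j + 1)) (hj : 2 / δ + 1 ≤ (j : ℝ))
    (hgood : GoodScale (δ / 2) R) : GoodScale δ (q ^ j) := by
  intro a b c habc hr
  have hq1 : (1 : ℝ) ≤ (q : ℝ) := by exact_mod_cast (le_trans (by norm_num) hq : 1 ≤ q)
  have hq0 : (0 : ℝ) ≤ (q : ℝ) := by linarith
  have hR0 : (0 : ℝ) ≤ (R : ℝ) := Nat.cast_nonneg R
  have hc : (c : ℝ) ≤ (R : ℝ) ^ (1 + δ / 2) := hgood a b c habc (le_trans hr hjR)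
  have hRq : (R : ℝ) ≤ (q : ℝ) ^ (j + 1) := by exact_mod_cast hRj.le
  -- exponent bookkeeping: (j+1)(1+δ/2) ≤ j(1+δ)
  have hjδ : 2 + δ ≤ (j : ℝ) * δ := by
    have h1 : (2 / δ + 1) * δ ≤ (j : ℝ) * δ := mul_le_mul_of_nonneg_right hj hδ.le
    have h2 : (2 / δ + 1) * δ = 2 + δ := by field_simp
    linarith
  have hexp : ((j : ℝ) + 1) * (1 + δ / 2) ≤ (j : ℝ) * (1 + δ) := by nlinarith
  calc (c : ℝ) ≤ (R : ℝ) ^ (1 + δ / 2) := hc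
    _ ≤ ((q : ℝ) ^ (j + 1)) ^ (1 + δ / 2) := Real.rpow_le_rpow hR0 hRq (by linarith)
    _ = (q : ℝ) ^ (((j : ℝ) + 1) * (1 + δ / 2)) := by
        rw [← Real.rpow_natCast (q : ℝ) (j + 1), ← Real.rpow_mul hq0]
        push_cast
        ring_nf
    _ ≤ (q : ℝ) ^ ((j : ℝ) * (1 + δ)) := Real.rpow_le_rpow_of_exponent_le hq1 hexp
    _ = ((q ^ j : ℕ) : ℝ) ^ (1 + δ) := by
        rw [Nat.cast_pow, ← Real.rpow_natCast (q : ℝ) j, ← Real.rpow_mul hq0]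

/-- **Geometric discretisation, hard direction.** Good scales beyond every bound give good
POWERS OF `q` beyond every bound (any base `q ≥ 2`). [folklore] -/
theorem geometric_of_sparseGoodScales {q : ℕ} (hq : 2 ≤ q) (h : SparseGoodScales) :
    GeometricGoodScales q := by
  intro δ hδ N
  obtain ⟨j₀, hj₀⟩ := exists_nat_ge (2 / δ + 1)
  obtain ⟨R, hRN, hgood⟩ := h (δ / 2) (by linarith) (q ^ max N j₀)
  have hq1 : 1 < q := lt_of_lt_of_le (by norm_num) hq
  have hR0 : R ≠ 0 := by
    have : 0 < q ^ max N j₀ := pow_pos (by omega) _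
    omega
  set j := Nat.log q R with hj
  have hjR : q ^ j ≤ R := Nat.pow_log_le_self q hR0
  have hRj : R < q ^ (j + 1) := Nat.lt_pow_succ_log_self hq1 R
  have hmax : max N j₀ ≤ j := Nat.le_log_of_pow_le hq1 hRN
  refine ⟨j, le_trans (le_max_left _ _) hmax, ?_⟩
  have hjge : 2 / δ + 1 ≤ (j : ℝ) := by
    have : (j₀ : ℝ) ≤ (j : ℝ) := by exact_mod_cast le_trans (le_max_right _ _) hmax
    linarith
  exact goodScale_pow_of_goodScale hq hδ hjR hRj hjge hgood

/-- **Geometric discretisation, easy direction.** [folklore] -/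
theorem sparseGoodScales_of_geometric {q : ℕ} (hq : 2 ≤ q) (h : GeometricGoodScales q) :
    SparseGoodScales := by
  intro δ hδ N
  obtain ⟨j, hjN, hgood⟩ := h δ hδ N
  have hq1 : 1 < q := lt_of_lt_of_le (by norm_num) hq
  refine ⟨q ^ j, le_trans hjN (Nat.lt_pow_self hq1).le, hgood⟩

/-- **`SparseGoodScales` ⟺ good powers of `q` beyond every bound** (every base `q ≥ 2`): the
crux may be decided along ONE geometric sequence of scales. [folklore] -/
theorem sparseGoodScales_iff_geometric {q : ℕ} (hq : 2 ≤ q) :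
    SparseGoodScales ↔ GeometricGoodScales q :=
  ⟨geometric_of_sparseGoodScales hq, sparseGoodScales_of_geometric hq⟩

/-- **The negation of the crux is a Silverman-profile sequence.** `¬ SparseGoodScales` iff for
some `δ₀ > 0`, below every large power `q^j` there is an abc triple with radical `≤ q^j` and
height `> (q^j)^{1+δ₀}` — the growth profile of `(1, q^{nj} − 1, q^{nj})` in the all-Wieferich
world (`sparseGoodScales_rad_family_le_of_levels_ge`), with the support of `c` unconstrained.
[folklore] -/
theorem not_sparseGoodScales_iff_profile {q : ℕ} (hq : 2 ≤ q) :
    ¬ SparseGoodScales ↔ ∃ δ : ℝ, 0 < δ ∧ ∃ N : ℕ, ∀ j : ℕ, N ≤ j →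
      ∃ a b c : ℕ, IsABCTriple a b c ∧ rad a b c ≤ q ^ j ∧
        ((q ^ j : ℕ) : ℝ) ^ (1 + δ) < (c : ℝ) := by
  rw [sparseGoodScales_iff_geometric hq]
  simp only [GeometricGoodScales, GoodScale]
  push Not
  rfl

end Summit.ABC.ABC.Cruxes.SparseGoodScales.GeometricScales

/-! ## The function-field floor: Wieferich primes divide the derivative of the base -/

namespace Summit.ABC.ABC.Cruxes.SparseGoodScales.FunctionFieldFloor

open Polynomial

/-- **Wieferich congruences in `F[X]` are killed by `d/dX`.**  If `P` is prime, `P ∤ a`,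
`(m : F) = −1` and `P² ∣ a^m − 1`, then `P ∣ a′`.  (Differentiate `a^m − 1 = P²M`:
`m·a^{m−1}·a′ = 2PP′M + P²M′`, and `m = −1` in `F`.)  With `F` finite of characteristic `p` and
`m = |F|^{deg P} − 1` this says: the Wieferich primes to a base `a` with `a′ ≠ 0` all divide
`a′` — finitely many; for an inseparable base (`a′ = 0`, `a` a `p`-th power) every prime is
Wieferich.  The integer analogue for the base `2` — infinitely many `p` with `2^{p−1} ≢ 1 (p²)` —
is open (Ribenboim 2004, Ch. 5 §III (2)) and is implied by the crux (p99695). [folklore] -/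
theorem prime_dvd_derivative_of_sq_dvd_pow_sub_one {F : Type*} [Field F] {P a : F[X]} {m : ℕ}
    (hP : Prime P) (hPa : ¬ P ∣ a) (hm : ((m : ℕ) : F) = -1) (h : P ^ 2 ∣ a ^ m - 1) :
    P ∣ derivative a := by
  obtain ⟨M, hM⟩ := h
  have hd : derivative (a ^ m - 1) = derivative (P ^ 2 * M) := by rw [hM]
  rw [derivative_sub, derivative_one, sub_zero, derivative_pow, derivative_mul,
    derivative_pow] at hd
  have h21 : (2 - 1 : ℕ) = 1 := rfl
  rw [h21, pow_one] at hd
  have hdvd : P ∣ C (m : F) * a ^ (m - 1) * derivative a := by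
    rw [hd]
    refine dvd_add ?_ ?_
    · exact dvd_mul_of_dvd_left (dvd_mul_of_dvd_left (dvd_mul_left P _) _) _
    · exact dvd_mul_of_dvd_left (dvd_pow_self P two_ne_zero) _
  rw [hm, map_neg, map_one, neg_one_mul, neg_mul, dvd_neg] at hdvd
  rcases hP.dvd_or_dvd hdvd with h1 | h2
  · exact absurd (hP.dvd_of_dvd_pow h1) hPa
  · exact h2

/-- In characteristic `p`, `m = p^k − 1` (`k ≥ 1`) satisfies `(m : F) = −1`; with
`p^k = |F|^{deg P}` this is the exponent of the Wieferich congruence in `F[X]`. [folklore] -/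
theorem cast_pow_sub_one_eq_neg_one (F : Type*) [Field F] (p : ℕ) [CharP F p] {k : ℕ}
    (hk : k ≠ 0) (hp : 1 ≤ p) : ((p ^ k - 1 : ℕ) : F) = -1 := by
  have h1 : 1 ≤ p ^ k := Nat.one_le_pow k p hp
  rw [Nat.cast_sub h1, Nat.cast_pow, CharP.cast_eq_zero F p, zero_pow hk, Nat.cast_one,
    zero_sub]

end Summit.ABC.ABC.Cruxes.SparseGoodScales.FunctionFieldFloor
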